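import Literature.AlgebraicGeometry.Frobenioids.PadicFrobenioidFieldUnitsAlgClosure
import Literature.AlgebraicGeometry.Frobenioids.PadicFrobenioidPairIsoTopological
import Literature.NumberTheory.GaloisRepresentations.GaloisCohomology
import HarnessLib

/-!
# Frobenioids II, Thm. 2.4 (ii): the pair `G₁ ⥲ G₂`, `K̄₁^× ⥲ K̄₂^×` ON THE ALGEBRAIC CLOSURES — `ψ̄ : ℚ̄_{p₁}^× ⥲ ℚ̄_{p₂}^×`
# with `ψ̄(σ·a) = ψ(σ)·ψ̄(a)`

Mochizuki, *The geometry of Frobenioids II*, Kyushu J. Math. **62** (2008) 401–460, §2, Theorem 2.4 (ii), author's text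
p. 19 [cite: MochizukiFrdII2008, Thm 2.4 p.19]: "`Ψ` … induces … an outer isomorphism of topological groups `Π₁ ⥲ Π₂` … that
lies over an outer isomorphism of topological groups `G₁ ⥲ G₂`"; proof of (ii), p. 20 l.−5 – p. 21 l. 6
[cite: MochizukiFrdII2008, Thm 2.4 (ii) p.21]: "`Ψ` induces a pair of compatible isomorphisms `G₁ ⥲ G₂`; `K̄₁^× ⥲ K̄₂^×`
[well-defined up to composition with an element of `G₂`]", `Gᵢ := Im(Πᵢ) ⊆ G_{ℚ_{pᵢ}}` (Def. 2.2, p. 17).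

PROOF-ONLY companion (cell abc-iut, `plan/L1/SUBDAG-FrdII-Thm24.md` row W12-L17 `PairIso`, node FrdII:Thm2.4(ii); seat
abc-iut-w5-d229).  `PadicFrobenioidPairIsoTopological` (abc-iut-w5-d229) gives the pair at the genuine bases as
(`φ : Π₁ ≃ₜ* Π₂`, `ψ : Im φ₁ ≃ₜ* Im φ₂`, `e : lim→_k K_{1,Π₁/N_k}^× ≅ lim→_k K_{2,Π₂/N₂,k}^×` `φ`-equivariant) with "`K̄ᵢ^×`"
the ABSTRACT direct limits; `PadicFrobenioidFieldUnitsAlgClosure` identifies those, equivariantly, with the literal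
`ℚ̄_{pᵢ}^× = (AlgebraicClosure ℚ_[pᵢ])ˣ`.  Here the two are composed:
* `exists_fbarUnitsEquiv_of_equivariant(_rep)` — DESCENT: every `φ`-equivariant `e` induces `ψ̄ = ι₂ ∘ e ∘ ι₁⁻¹ :
  ℚ̄_{p₁}^× ≃* ℚ̄_{p₂}^×` with `ψ̄(φ₁(g)·a) = φ₂(φ g)·ψ̄(a)` (the `_rep` form also returns the identifications `ιᵢ`, their
  leg formulas `a ↦ x_{i,k}⁻¹·a`, and `ψ̄ ∘ ι₁ = ι₂ ∘ e`);
* `exists_pairIso_fbarUnits` — **the assembled printed statement** for fieldwise saturated data over the genuine bases,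
  `E = Ψ^Base` with the row-L02 slot `ΨB`: `φ : Π₁ ≃ₜ* Π₂` (`φ(Ker φ₁) = Ker φ₂`), its homeomorphic descent `ψ : G₁ ≃ₜ* G₂`
  (`ψ ∘ φ₁ = φ₂ ∘ φ`), and **`ψ̄ : ℚ̄_{p₁}^× ≃* ℚ̄_{p₂}^×` with `ψ̄(φ₁(g)·a) = φ₂(φ g)·ψ̄(a)`, i.e. `ψ̄(σ·a) = ψ(σ)·ψ̄(a)` for
  all `σ ∈ G₁`** — "a pair of COMPATIBLE isomorphisms `G₁ ⥲ G₂`; `K̄₁^× ⥲ K̄₂^×`" with `K̄ᵢ` the actual algebraic closures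
  (the `G₂`-twist of the straightening is absorbed into `ψ̄`, so the compatibility holds on the nose along the descended `ψ`);
* `exists_pairIso_fbarUnits_smul` — the same in the `IsAlphaEquivariant` shape of [AbsAnab] Prop. 1.2.1 (vi)
  (`AbsAnabProp121viiSub`: `ψ̄ (σ • a) = α σ • ψ̄ a` for the tree's action of `Field.absoluteGaloisGroup` on `(K̄)ˣ`), which
  is the `ψ̄`-shape of the Frobenioid-side residual (R2) of W12's Thm. 2.4 (ii) closer (abc-iut-w5-d201);
* `exists_pairIso_fbarUnits_zero(_galQp)` — non-vacuity (`C₀|_D`, `Ψ = 𝟭`; no-hypothesis instance at `Π = G_{ℚ_p}`).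
Theorems only (no definitions); nothing here bears on [IUTchIII] Cor. 3.12.
-/

noncomputable section

namespace Literature.AlgebraicGeometry.Frobenioids

open CategoryTheory CategoryTheory.Limits Opposite Topology Filter
open Literature.AnabelianGeometry.SemiGraphs QuasiTemperoid

namespace BaseGaloisSystem

/-! ### §3 An equivariant pair of direct limits DESCENDS to `ψ̄ : ℚ̄_{p₁}^× ⥲ ℚ̄_{p₂}^×`, equivariant along `φ` -/

section Descent

variable {p₁ p₂ : ℕ} [Fact p₁.Prime] [Fact p₂.Prime]
  {G : Type} [Group G] [TopologicalSpace G] {G₂ : Type} [Group G₂] [TopologicalSpace G₂]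
  (φ₁ : G →* GalFbar ℚ_[p₁]) (hφ₁ : IsOpenHom φ₁) (φ₂ : G₂ →* GalFbar ℚ_[p₂]) (hφ₂ : IsOpenHom φ₂)
  (N : ℕ → OpenNormalSubgroup G) (hN : Antitone N) (N₂ : ℕ → OpenNormalSubgroup G₂) (hN₂ : Antitone N₂)

/-- **Descent to the algebraic closures, with the identifications exposed.**  Over the genuine bases and for chosen
base-point representatives `x_{1,k}`, `x_{2,k}`, EVERY `φ`-equivariant isomorphism
`e : lim→_k K_{1,Π₁/N_k}^× ≅ lim→_k K_{2,Π₂/N₂,k}^×` (`e ∘ r_g = r_{φ g} ∘ e`, `φ : Π₁ → Π₂` any map) induces — through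
the identifications `ιᵢ : lim→ ⥲ ℚ̄_{pᵢ}^×` of `exists_colimitIso_fbarUnits` (leg `k` = `a ↦ x_{i,k}⁻¹·a`) — an isomorphism
`ψ̄ = ι₂ ∘ e ∘ ι₁⁻¹ : ℚ̄_{p₁}^× ⥲ ℚ̄_{p₂}^×` with `ψ̄(φ₁(g)·a) = φ₂(φ g)·ψ̄(a)`: the printed "compatible isomorphisms
`G₁ ⥲ G₂`; `K̄₁^× ⥲ K̄₂^×`" on the ACTUAL multiplicative groups of the algebraic closures, together with the data
relating `ψ̄` to `e` levelwise. [cite: MochizukiFrdII2008, Thm 2.4 (ii) p.21] -/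
theorem exists_fbarUnitsEquiv_of_equivariant_rep
    (hNb : ∀ U ∈ 𝓝 (1 : G), ∃ k, (N k : Set G) ⊆ U) (hN₂b : ∀ U ∈ 𝓝 (1 : G₂), ∃ k, (N₂ k : Set G₂) ⊆ U)
    (x₁ : ℕ → GalFbar ℚ_[p₁])
    (hx₁ : ∀ k, (x₁ k : ((CosetCat.push φ₁ hφ₁.isOpenMap).obj (cQ (N k))).carrier) =
      (basePt ((CosetCat.toConnected (isTempered_galFbar ℚ_[p₁])).obj ((CosetCat.push φ₁ hφ₁.isOpenMap).obj (cQ (N k)))) :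
        ((CosetCat.push φ₁ hφ₁.isOpenMap).obj (cQ (N k))).carrier))
    (x₂ : ℕ → GalFbar ℚ_[p₂])
    (hx₂ : ∀ k, (x₂ k : ((CosetCat.push φ₂ hφ₂.isOpenMap).obj (cQ (N₂ k))).carrier) =
      (basePt ((CosetCat.toConnected (isTempered_galFbar ℚ_[p₂])).obj ((CosetCat.push φ₂ hφ₂.isOpenMap).obj (cQ (N₂ k)))) :
        ((CosetCat.push φ₂ hφ₂.isOpenMap).obj (cQ (N₂ k))).carrier))
    [HasColimit (cosetSystem N hN ⋙ PadicFrd.bZeroOn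
      (CosetCat.push φ₁ hφ₁.isOpenMap ⋙ CosetCat.toConnected (isTempered_galFbar ℚ_[p₁]) ⋙ galoisPadicFields p₁))]
    [HasColimit (cosetSystem N₂ hN₂ ⋙ PadicFrd.bZeroOn
      (CosetCat.push φ₂ hφ₂.isOpenMap ⋙ CosetCat.toConnected (isTempered_galFbar ℚ_[p₂]) ⋙ galoisPadicFields p₂))]
    (φ : G → G₂)
    (e : colimit (cosetSystem N hN ⋙ PadicFrd.bZeroOn
        (CosetCat.push φ₁ hφ₁.isOpenMap ⋙ CosetCat.toConnected (isTempered_galFbar ℚ_[p₁]) ⋙ galoisPadicFields p₁)) ≅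
      colimit (cosetSystem N₂ hN₂ ⋙ PadicFrd.bZeroOn
        (CosetCat.push φ₂ hφ₂.isOpenMap ⋙ CosetCat.toConnected (isTempered_galFbar ℚ_[p₂]) ⋙ galoisPadicFields p₂)))
    (he : ∀ g : G,
      e.hom ≫ colimMap (Functor.whiskerRight (toAutCoset N₂ hN₂ (φ g)).hom (PadicFrd.bZeroOn
        (CosetCat.push φ₂ hφ₂.isOpenMap ⋙ CosetCat.toConnected (isTempered_galFbar ℚ_[p₂]) ⋙ galoisPadicFields p₂))) =
      colimMap (Functor.whiskerRight (toAutCoset N hN g).hom (PadicFrd.bZeroOn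
        (CosetCat.push φ₁ hφ₁.isOpenMap ⋙ CosetCat.toConnected (isTempered_galFbar ℚ_[p₁]) ⋙ galoisPadicFields p₁))) ≫
        e.hom) :
    ∃ (ι₁ : colimit (cosetSystem N hN ⋙ PadicFrd.bZeroOn
          (CosetCat.push φ₁ hφ₁.isOpenMap ⋙ CosetCat.toConnected (isTempered_galFbar ℚ_[p₁]) ⋙ galoisPadicFields p₁)) ≅
          CommMonCat.of (Fbar ℚ_[p₁])ˣ)
      (ι₂ : colimit (cosetSystem N₂ hN₂ ⋙ PadicFrd.bZeroOn
          (CosetCat.push φ₂ hφ₂.isOpenMap ⋙ CosetCat.toConnected (isTempered_galFbar ℚ_[p₂]) ⋙ galoisPadicFields p₂)) ≅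
          CommMonCat.of (Fbar ℚ_[p₂])ˣ)
      (ψbar : (Fbar ℚ_[p₁])ˣ ≃* (Fbar ℚ_[p₂])ˣ),
      (∀ (k : ℕ) (u : (cosetSystem N hN ⋙ PadicFrd.bZeroOn
          (CosetCat.push φ₁ hφ₁.isOpenMap ⋙ CosetCat.toConnected (isTempered_galFbar ℚ_[p₁]) ⋙ galoisPadicFields p₁)).obj k),
        ((ι₁.hom (colimit.ι (cosetSystem N hN ⋙ PadicFrd.bZeroOn
          (CosetCat.push φ₁ hφ₁.isOpenMap ⋙ CosetCat.toConnected (isTempered_galFbar ℚ_[p₁]) ⋙ galoisPadicFields p₁)) k u) :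
            (Fbar ℚ_[p₁])ˣ) : Fbar ℚ_[p₁]) =
          (x₁ k)⁻¹ (((show (fixFld ℚ_[p₁] ((CosetCat.toConnected (isTempered_galFbar ℚ_[p₁])).obj
            ((CosetCat.push φ₁ hφ₁.isOpenMap).obj (cQ (N k)))))ˣ from u) :
            fixFld ℚ_[p₁] ((CosetCat.toConnected (isTempered_galFbar ℚ_[p₁])).obj
              ((CosetCat.push φ₁ hφ₁.isOpenMap).obj (cQ (N k))))) : Fbar ℚ_[p₁])) ∧
      (∀ (k : ℕ) (u : (cosetSystem N₂ hN₂ ⋙ PadicFrd.bZeroOn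
          (CosetCat.push φ₂ hφ₂.isOpenMap ⋙ CosetCat.toConnected (isTempered_galFbar ℚ_[p₂]) ⋙ galoisPadicFields p₂)).obj k),
        ((ι₂.hom (colimit.ι (cosetSystem N₂ hN₂ ⋙ PadicFrd.bZeroOn
          (CosetCat.push φ₂ hφ₂.isOpenMap ⋙ CosetCat.toConnected (isTempered_galFbar ℚ_[p₂]) ⋙ galoisPadicFields p₂)) k u) :
            (Fbar ℚ_[p₂])ˣ) : Fbar ℚ_[p₂]) =
          (x₂ k)⁻¹ (((show (fixFld ℚ_[p₂] ((CosetCat.toConnected (isTempered_galFbar ℚ_[p₂])).obj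
            ((CosetCat.push φ₂ hφ₂.isOpenMap).obj (cQ (N₂ k)))))ˣ from u) :
            fixFld ℚ_[p₂] ((CosetCat.toConnected (isTempered_galFbar ℚ_[p₂])).obj
              ((CosetCat.push φ₂ hφ₂.isOpenMap).obj (cQ (N₂ k))))) : Fbar ℚ_[p₂])) ∧
      (∀ z, ψbar (ι₁.hom z) = ι₂.hom (e.hom z)) ∧
      ∀ (g : G) (u : (Fbar ℚ_[p₁])ˣ),
        ψbar (Units.map ((φ₁ g : GalFbar ℚ_[p₁]) : Fbar ℚ_[p₁] →* Fbar ℚ_[p₁]) u) =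
          Units.map ((φ₂ (φ g) : GalFbar ℚ_[p₂]) : Fbar ℚ_[p₂] →* Fbar ℚ_[p₂]) (ψbar u) := by
  obtain ⟨ι₁, hleg₁, hι₁⟩ := exists_colimitIso_fbarUnits φ₁ hφ₁ N hN hNb x₁ hx₁
  obtain ⟨ι₂, hleg₂, hι₂⟩ := exists_colimitIso_fbarUnits φ₂ hφ₂ N₂ hN₂ hN₂b x₂ hx₂
  refine ⟨ι₁, ι₂, (ι₁.symm ≪≫ e ≪≫ ι₂).commMonCatIsoToMulEquiv, hleg₁, hleg₂, fun z => ?_, fun g u => ?_⟩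
  · change (ι₁.inv ≫ e.hom ≫ ι₂.hom) (ι₁.hom z) = ι₂.hom (e.hom z)
    rw [CommMonCat.comp_apply, CommMonCat.comp_apply, ← CommMonCat.comp_apply ι₁.hom, Iso.hom_inv_id,
      CommMonCat.id_apply]
  -- the three squares compose
  have h1 : CommMonCat.ofHom (Units.map ((φ₁ g : GalFbar ℚ_[p₁]) : Fbar ℚ_[p₁] →* Fbar ℚ_[p₁])) ≫ ι₁.inv =
      ι₁.inv ≫ colimMap (Functor.whiskerRight (toAutCoset N hN g).hom (PadicFrd.bZeroOn
        (CosetCat.push φ₁ hφ₁.isOpenMap ⋙ CosetCat.toConnected (isTempered_galFbar ℚ_[p₁]) ⋙ galoisPadicFields p₁))) := by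
    rw [Iso.eq_inv_comp, ← Category.assoc, ← hι₁ g, Category.assoc, Iso.hom_inv_id, Category.comp_id]
  have hsq : CommMonCat.ofHom (Units.map ((φ₁ g : GalFbar ℚ_[p₁]) : Fbar ℚ_[p₁] →* Fbar ℚ_[p₁])) ≫
        (ι₁.symm ≪≫ e ≪≫ ι₂).hom =
      (ι₁.symm ≪≫ e ≪≫ ι₂).hom ≫ CommMonCat.ofHom (Units.map ((φ₂ (φ g) : GalFbar ℚ_[p₂]) : Fbar ℚ_[p₂] →* Fbar ℚ_[p₂])) := by
    simp only [Iso.trans_hom, Iso.symm_hom, Category.assoc]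
    rw [← Category.assoc, h1, Category.assoc, ← reassoc_of% (he g), hι₂ (φ g)]
  have h := ConcreteCategory.congr_hom hsq u
  exact h

/-- **Descent to the algebraic closures.**  Over the genuine bases, EVERY `φ`-equivariant isomorphism
`e : lim→_k K_{1,Π₁/N_k}^× ≅ lim→_k K_{2,Π₂/N₂,k}^×` (`e ∘ r_g = r_{φ g} ∘ e`, `φ : Π₁ → Π₂` any map) induces an
isomorphism `ψ̄ : ℚ̄_{p₁}^× ⥲ ℚ̄_{p₂}^×` with `ψ̄(φ₁(g)·a) = φ₂(φ g)·ψ̄(a)` — the printed "compatible isomorphisms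
`G₁ ⥲ G₂`; `K̄₁^× ⥲ K̄₂^×`" on the ACTUAL multiplicative groups of the algebraic closures (representatives chosen,
identifications suppressed: `exists_fbarUnitsEquiv_of_equivariant_rep`). [cite: MochizukiFrdII2008, Thm 2.4 (ii) p.21] -/
theorem exists_fbarUnitsEquiv_of_equivariant
    (hNb : ∀ U ∈ 𝓝 (1 : G), ∃ k, (N k : Set G) ⊆ U) (hN₂b : ∀ U ∈ 𝓝 (1 : G₂), ∃ k, (N₂ k : Set G₂) ⊆ U)
    [HasColimit (cosetSystem N hN ⋙ PadicFrd.bZeroOn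
      (CosetCat.push φ₁ hφ₁.isOpenMap ⋙ CosetCat.toConnected (isTempered_galFbar ℚ_[p₁]) ⋙ galoisPadicFields p₁))]
    [HasColimit (cosetSystem N₂ hN₂ ⋙ PadicFrd.bZeroOn
      (CosetCat.push φ₂ hφ₂.isOpenMap ⋙ CosetCat.toConnected (isTempered_galFbar ℚ_[p₂]) ⋙ galoisPadicFields p₂))]
    (φ : G → G₂)
    (e : colimit (cosetSystem N hN ⋙ PadicFrd.bZeroOn
        (CosetCat.push φ₁ hφ₁.isOpenMap ⋙ CosetCat.toConnected (isTempered_galFbar ℚ_[p₁]) ⋙ galoisPadicFields p₁)) ≅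
      colimit (cosetSystem N₂ hN₂ ⋙ PadicFrd.bZeroOn
        (CosetCat.push φ₂ hφ₂.isOpenMap ⋙ CosetCat.toConnected (isTempered_galFbar ℚ_[p₂]) ⋙ galoisPadicFields p₂)))
    (he : ∀ g : G,
      e.hom ≫ colimMap (Functor.whiskerRight (toAutCoset N₂ hN₂ (φ g)).hom (PadicFrd.bZeroOn
        (CosetCat.push φ₂ hφ₂.isOpenMap ⋙ CosetCat.toConnected (isTempered_galFbar ℚ_[p₂]) ⋙ galoisPadicFields p₂))) =
      colimMap (Functor.whiskerRight (toAutCoset N hN g).hom (PadicFrd.bZeroOn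
        (CosetCat.push φ₁ hφ₁.isOpenMap ⋙ CosetCat.toConnected (isTempered_galFbar ℚ_[p₁]) ⋙ galoisPadicFields p₁))) ≫
        e.hom) :
    ∃ ψbar : (Fbar ℚ_[p₁])ˣ ≃* (Fbar ℚ_[p₂])ˣ,
      ∀ (g : G) (u : (Fbar ℚ_[p₁])ˣ),
        ψbar (Units.map ((φ₁ g : GalFbar ℚ_[p₁]) : Fbar ℚ_[p₁] →* Fbar ℚ_[p₁]) u) =
          Units.map ((φ₂ (φ g) : GalFbar ℚ_[p₂]) : Fbar ℚ_[p₂] →* Fbar ℚ_[p₂]) (ψbar u) := by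
  obtain ⟨x₁, hx₁⟩ := exists_rep_basePt_seq φ₁ hφ₁ N
  obtain ⟨x₂, hx₂⟩ := exists_rep_basePt_seq φ₂ hφ₂ N₂
  obtain ⟨-, -, ψbar, -, -, -, hψbar⟩ :=
    exists_fbarUnitsEquiv_of_equivariant_rep φ₁ hφ₁ φ₂ hφ₂ N hN N₂ hN₂ hNb hN₂b x₁ hx₁ x₂ hx₂ φ e he
  exact ⟨ψbar, hψbar⟩

end Descent

/-! ### §4 The assembled printed statement: the pair `G₁ ⥲ G₂`, `ℚ̄_{p₁}^× ⥲ ℚ̄_{p₂}^×` for fieldwise saturated Frobenioids -/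

section Assembled

variable {p₁ p₂ : ℕ} [Fact p₁.Prime] [Fact p₂.Prime]
  {G : Type} [Group G] [TopologicalSpace G] [IsTopologicalGroup G] (hG : IsTempered G)
  {G₂ : Type} [Group G₂] [TopologicalSpace G₂] [IsTopologicalGroup G₂] (hG₂ : IsTempered G₂)
  (φ₁ : G →* GalFbar ℚ_[p₁]) (hφ₁ : IsOpenHom φ₁) (φ₂ : G₂ →* GalFbar ℚ_[p₂]) (hφ₂ : IsOpenHom φ₂)
  (N : ℕ → OpenNormalSubgroup G) (hN : Antitone N)
  (d₁ : PadicFrd.Datum (CosetCat G) p₁) (d₂ : PadicFrd.Datum (CosetCat G₂) p₂)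

include hG hG₂ hN in
/-- **[FrdII] Thm. 2.4 (ii) — "`Ψ` induces a pair of compatible isomorphisms `G₁ ⥲ G₂`; `K̄₁^× ⥲ K̄₂^×`" ON THE ALGEBRAIC
CLOSURES.**  For fieldwise saturated `pᵢ`-adic Frobenioid data over the genuine bases `𝓑^temp(Πᵢ)⁰ → D₀` (through open
homomorphisms `φᵢ : Πᵢ → G_{ℚ_{pᵢ}}`, `Gᵢ := Im φᵢ`), `E = Ψ^Base` with the row-L02 slot `ΨB`, and a cofinal antitone tower
for `Π₁`: there are a topological isomorphism `φ : Π₁ ≃ₜ* Π₂` with `φ(Ker φ₁) = Ker φ₂`, its homeomorphic descent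
`ψ : G₁ ≃ₜ* G₂` (`ψ ∘ φ₁ = φ₂ ∘ φ`), and **`ψ̄ : ℚ̄_{p₁}^× ≃* ℚ̄_{p₂}^×` with `ψ̄(φ₁(g)·a) = φ₂(φ g)·ψ̄(a)`**, equivalently
`ψ̄(σ·a) = ψ(σ)·ψ̄(a)` for all `σ ∈ G₁` — the printed compatible pair, with `K̄ᵢ` the ACTUAL algebraic closures
`ℚ̄_{pᵢ}`. [cite: MochizukiFrdII2008, Thm 2.4 (ii) p.21] -/
theorem exists_pairIso_fbarUnits
    (hd₁ : d₁.base = CosetCat.push φ₁ hφ₁.isOpenMap ⋙ CosetCat.toConnected (isTempered_galFbar ℚ_[p₁]) ⋙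
      galoisPadicFields p₁)
    (hd₂ : d₂.base = CosetCat.push φ₂ hφ₂.isOpenMap ⋙ CosetCat.toConnected (isTempered_galFbar ℚ_[p₂]) ⋙
      galoisPadicFields p₂)
    (hfs₁ : d₁.IsFieldwiseSaturated) (hfs₂ : d₂.IsFieldwiseSaturated)
    (E : CosetCat G ≌ CosetCat G₂) (ΨB : d₁.B ≅ E.functor.op ⋙ d₂.B)
    (hNb : ∀ U ∈ 𝓝 (1 : G), ∃ k, (N k : Set G) ⊆ U) :
    ∃ (φ : G ≃ₜ* G₂) (ψ : φ₁.range ≃ₜ* φ₂.range) (ψbar : (Fbar ℚ_[p₁])ˣ ≃* (Fbar ℚ_[p₂])ˣ),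
      φ₁.ker.map φ.toMulEquiv.toMonoidHom = φ₂.ker ∧
      (∀ g : G, (ψ ⟨φ₁ g, ⟨g, rfl⟩⟩ : GalFbar ℚ_[p₂]) = φ₂ (φ g)) ∧
      (∀ (g : G) (u : (Fbar ℚ_[p₁])ˣ),
        ψbar (Units.map ((φ₁ g : GalFbar ℚ_[p₁]) : Fbar ℚ_[p₁] →* Fbar ℚ_[p₁]) u) =
          Units.map ((φ₂ (φ g) : GalFbar ℚ_[p₂]) : Fbar ℚ_[p₂] →* Fbar ℚ_[p₂]) (ψbar u)) ∧
      ∀ (σ : φ₁.range) (u : (Fbar ℚ_[p₁])ˣ),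
        ψbar (Units.map ((σ : GalFbar ℚ_[p₁]) : Fbar ℚ_[p₁] →* Fbar ℚ_[p₁]) u) =
          Units.map (((ψ σ : φ₂.range) : GalFbar ℚ_[p₂]) : Fbar ℚ_[p₂] →* Fbar ℚ_[p₂]) (ψbar u) := by
  haveI := hasColimitsOfShape_nat_commMonCat.{0}
  obtain ⟨base₁, hloc₁, hc₁, he₁, Φ₁, ι₁, hι₁, hmono₁, B₁, toB0₁, divB₁, sq₁, cart₁, nz₁⟩ := d₁
  obtain ⟨base₂, hloc₂, hc₂, he₂, Φ₂, ι₂, hι₂, hmono₂, B₂, toB0₂, divB₂, sq₂, cart₂, nz₂⟩ := d₂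
  cases hd₁
  cases hd₂
  obtain ⟨φ, ψ, N₂, hN₂, hN₂b, -, e, hker, hψ, he⟩ :=
    exists_pairIso_range_topological hG hG₂ φ₁ hφ₁ φ₂ hφ₂ N hN _ _ rfl rfl hfs₁ hfs₂ E ΨB hNb
  obtain ⟨ψbar, hψbar⟩ :=
    exists_fbarUnitsEquiv_of_equivariant φ₁ hφ₁ φ₂ hφ₂ N hN N₂ hN₂ hNb hN₂b φ e he
  refine ⟨φ, ψ, ψbar, hker, hψ, hψbar, fun σ u => ?_⟩
  obtain ⟨_, g, rfl⟩ := σ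
  rw [hψbar g u, ← hψ g]

include hG hG₂ hN in
/-- **The same, in the `IsAlphaEquivariant` shape** of [AbsAnab] Prop. 1.2.1 (vi)/(vii) (`AbsAnabProp121viiSub`): with
`G_{ℚ_{pᵢ}} = Gal(ℚ̄_{pᵢ}/ℚ_{pᵢ})` acting on `ℚ̄_{pᵢ}^×` (`Field.absoluteGaloisGroup`, the tree's units action),
`ψ̄ (φ₁(g) • a) = φ₂(φ g) • ψ̄ a`. [cite: MochizukiFrdII2008, Thm 2.4 (ii) p.21] -/
theorem exists_pairIso_fbarUnits_smul
    (hd₁ : d₁.base = CosetCat.push φ₁ hφ₁.isOpenMap ⋙ CosetCat.toConnected (isTempered_galFbar ℚ_[p₁]) ⋙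
      galoisPadicFields p₁)
    (hd₂ : d₂.base = CosetCat.push φ₂ hφ₂.isOpenMap ⋙ CosetCat.toConnected (isTempered_galFbar ℚ_[p₂]) ⋙
      galoisPadicFields p₂)
    (hfs₁ : d₁.IsFieldwiseSaturated) (hfs₂ : d₂.IsFieldwiseSaturated)
    (E : CosetCat G ≌ CosetCat G₂) (ΨB : d₁.B ≅ E.functor.op ⋙ d₂.B)
    (hNb : ∀ U ∈ 𝓝 (1 : G), ∃ k, (N k : Set G) ⊆ U) :
    ∃ (φ : G ≃ₜ* G₂) (ψ : φ₁.range ≃ₜ* φ₂.range) (ψbar : (AlgebraicClosure ℚ_[p₁])ˣ ≃* (AlgebraicClosure ℚ_[p₂])ˣ),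
      φ₁.ker.map φ.toMulEquiv.toMonoidHom = φ₂.ker ∧
      (∀ g : G, (ψ ⟨φ₁ g, ⟨g, rfl⟩⟩ : GalFbar ℚ_[p₂]) = φ₂ (φ g)) ∧
      ∀ (g : G) (u : (AlgebraicClosure ℚ_[p₁])ˣ),
        ψbar ((show Field.absoluteGaloisGroup ℚ_[p₁] from φ₁ g) • u) =
          (show Field.absoluteGaloisGroup ℚ_[p₂] from φ₂ (φ g)) • ψbar u := by
  obtain ⟨φ, ψ, ψbar, hker, hψ, hψbar, -⟩ :=
    exists_pairIso_fbarUnits hG hG₂ φ₁ hφ₁ φ₂ hφ₂ N hN d₁ d₂ hd₁ hd₂ hfs₁ hfs₂ E ΨB hNb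
  refine ⟨φ, ψ, ψbar, hker, hψ, fun g u => ?_⟩
  have h1 : (show Field.absoluteGaloisGroup ℚ_[p₁] from φ₁ g) • u =
      Units.map ((φ₁ g : GalFbar ℚ_[p₁]) : Fbar ℚ_[p₁] →* Fbar ℚ_[p₁]) u := Units.ext rfl
  have h2 : (show Field.absoluteGaloisGroup ℚ_[p₂] from φ₂ (φ g)) • ψbar u =
      Units.map ((φ₂ (φ g) : GalFbar ℚ_[p₂]) : Fbar ℚ_[p₂] →* Fbar ℚ_[p₂]) (ψbar u) := Units.ext rfl
  rw [h1, h2, hψbar]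

end Assembled

/-! ### §5 Non-vacuity -/

section NonVacuity

variable {p : ℕ} [Fact p.Prime] {G : Type} [Group G] [TopologicalSpace G] [IsTopologicalGroup G]
  [SecondCountableTopology G] (hG : IsTempered G) (φ₀ : G →* GalFbar ℚ_[p]) (hφ₀ : IsOpenHom φ₀)

include hG hφ₀ in
/-- **Kernel instance over an arbitrary genuine base.**  For `Π` tempered and Galois-countable with an open homomorphism
`φ₀ : Π → G_{ℚ_p}`, the datum `C₀|_D` (`PadicFrd.Datum.zero`) with `Ψ = 𝟭` meets every hypothesis of
`exists_pairIso_fbarUnits`: the pair `Π ⥲ Π`, `Im φ₀ ⥲ Im φ₀`, `ℚ̄_p^× ⥲ ℚ̄_p^×` with its compatibilities EXISTS.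
[cite: MochizukiFrdII2008, Thm 2.4 (ii) p.21] -/
theorem exists_pairIso_fbarUnits_zero :
    ∃ (N : ℕ → OpenNormalSubgroup G) (_ : Antitone N) (_ : ∀ U ∈ 𝓝 (1 : G), ∃ k, (N k : Set G) ⊆ U)
      (φ : G ≃ₜ* G) (ψ : φ₀.range ≃ₜ* φ₀.range) (ψbar : (Fbar ℚ_[p])ˣ ≃* (Fbar ℚ_[p])ˣ),
      φ₀.ker.map φ.toMulEquiv.toMonoidHom = φ₀.ker ∧
      (∀ g : G, (ψ ⟨φ₀ g, ⟨g, rfl⟩⟩ : GalFbar ℚ_[p]) = φ₀ (φ g)) ∧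
      (∀ (g : G) (u : (Fbar ℚ_[p])ˣ),
        ψbar (Units.map ((φ₀ g : GalFbar ℚ_[p]) : Fbar ℚ_[p] →* Fbar ℚ_[p]) u) =
          Units.map ((φ₀ (φ g) : GalFbar ℚ_[p]) : Fbar ℚ_[p] →* Fbar ℚ_[p]) (ψbar u)) ∧
      ∀ (σ : φ₀.range) (u : (Fbar ℚ_[p])ˣ),
        ψbar (Units.map ((σ : GalFbar ℚ_[p]) : Fbar ℚ_[p] →* Fbar ℚ_[p]) u) =
          Units.map (((ψ σ : φ₀.range) : GalFbar ℚ_[p]) : Fbar ℚ_[p] →* Fbar ℚ_[p]) (ψbar u) := by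
  obtain ⟨N, hN, hNb⟩ := exists_antitone_cofinal_seq hG
  let d : PadicFrd.Datum (CosetCat G) p :=
    PadicFrd.Datum.zero (CosetCat.push φ₀ hφ₀.isOpenMap ⋙ CosetCat.toConnected (isTempered_galFbar ℚ_[p]) ⋙
        galoisPadicFields p) (fun _ => isPadicLocal_galoisPadicFields p _) CosetCat.isConnected
      CosetCat.isTotallyEpimorphic (isMonoprime_ordInt_genuine φ₀ hφ₀)
  obtain ⟨φ, ψ, ψbar, hker, hψ, hψbar, hσ⟩ := exists_pairIso_fbarUnits hG hG φ₀ hφ₀ φ₀ hφ₀ N hN d d rfl rfl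
    (PadicFrd.Datum.isFieldwiseSaturated_zero _ _ _ _ _) (PadicFrd.Datum.isFieldwiseSaturated_zero _ _ _ _ _)
    CategoryTheory.Equivalence.refl (Iso.refl _) hNb
  exact ⟨N, hN, hNb, φ, ψ, ψbar, hker, hψ, hψbar, hσ⟩

/-- **No-hypothesis kernel instance**: `Π = G_{ℚ_p}` (`isTempered_galFbar`, Galois-countable by
`secondCountableTopology_galFbar_padic`), `φ₀ = id`, `C₀`, `Ψ = 𝟭` — every displayed hypothesis is jointly satisfiable and
the pair on the algebraic closure EXISTS. [cite: MochizukiFrdII2008, Thm 2.4 (ii) p.21] -/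
theorem exists_pairIso_fbarUnits_zero_galQp (p : ℕ) [Fact p.Prime] :
    ∃ (N : ℕ → OpenNormalSubgroup (GalFbar ℚ_[p])) (_ : Antitone N)
      (_ : ∀ U ∈ 𝓝 (1 : GalFbar ℚ_[p]), ∃ k, (N k : Set (GalFbar ℚ_[p])) ⊆ U)
      (φ : GalFbar ℚ_[p] ≃ₜ* GalFbar ℚ_[p])
      (ψ : (MonoidHom.id (GalFbar ℚ_[p])).range ≃ₜ* (MonoidHom.id (GalFbar ℚ_[p])).range)
      (ψbar : (Fbar ℚ_[p])ˣ ≃* (Fbar ℚ_[p])ˣ),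
      (MonoidHom.id _).ker.map φ.toMulEquiv.toMonoidHom = (MonoidHom.id _).ker ∧
      (∀ g : GalFbar ℚ_[p], (ψ ⟨g, ⟨g, rfl⟩⟩ : GalFbar ℚ_[p]) = φ g) ∧
      (∀ (g : GalFbar ℚ_[p]) (u : (Fbar ℚ_[p])ˣ),
        ψbar (Units.map (g : Fbar ℚ_[p] →* Fbar ℚ_[p]) u) = Units.map ((φ g : GalFbar ℚ_[p]) : Fbar ℚ_[p] →* Fbar ℚ_[p]) (ψbar u)) ∧
      ∀ (σ : (MonoidHom.id (GalFbar ℚ_[p])).range) (u : (Fbar ℚ_[p])ˣ),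
        ψbar (Units.map ((σ : GalFbar ℚ_[p]) : Fbar ℚ_[p] →* Fbar ℚ_[p]) u) =
          Units.map (((ψ σ : (MonoidHom.id (GalFbar ℚ_[p])).range) : GalFbar ℚ_[p]) : Fbar ℚ_[p] →* Fbar ℚ_[p]) (ψbar u) :=
  haveI := secondCountableTopology_galFbar_padic p
  exists_pairIso_fbarUnits_zero (isTempered_galFbar ℚ_[p]) (MonoidHom.id _) ⟨continuous_id, IsOpenMap.id⟩

end NonVacuity

end BaseGaloisSystem

end Literature.AlgebraicGeometry.Frobenioids

end
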